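import Summits.QuantumFields.YangMills.Theorems.LatticeGapOnTrajectory.Negative.StubUVPassage

/-!
# Stub 3 `ScaleAnchoring` of the skeleton `dissipative-bridge` (crux `LatticeGapOnTrajectory`, stmt-QuantumFields-10523)
is a theorem of the chart's UV pin and the drift count

Refuter (cdisprove gen 3) file on the Negative lane (sequel of `Negative.StubUVPassage`). `BridgeChart` is a verbatim
copy of the skeleton's posited object (its `attribute [instance]` line included: the Banach instances of the chart
space `X` are carried by the structure); `scaleAnchoring_holds` has the inline statement equal to the body of
`DissipativeBridge.ScaleAnchoring` (sha 4ba1ce0c…), so `stub_anchoring : ScaleAnchoring := scaleAnchoring_holds`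
modulo replacing the copy `BridgeChart` by the skeleton's (same fields). No route statement is asserted.
-/

namespace Summit.QuantumFields.YangMills.Theorems.LatticeGapOnTrajectory.Negative.Stubs

open Filter Topology
open Literature.MathematicalPhysics.QuantumFieldTheory

noncomputable section

section StructureCopy

variable {G : Type} [Group G] [TopologicalSpace G] [IsTopologicalGroup G] [CompactSpace G]
  [MeasurableSpace G] [BorelSpace G] {r : LatticeRep G} {M' : ℕ}

/-- COPY of `DissipativeBridge.BridgeChart` (the line's posited object; fields verbatim). [folklore] -/
structure BridgeChart (S : BalabanBanachStep G r M') where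
  odd_M : Odd M'
  X : Type
  [instNormedAddCommGroup : NormedAddCommGroup X]
  [instNormedSpace : NormedSpace ℝ X]
  [instCompleteSpace : CompleteSpace X]
  F : X → X
  ι : ℝ × S.E → X
  ι_step : ∀ p : ℝ × S.E, p.1 ∈ Set.Icc 0 S.δ → ‖p.2‖ ≤ S.R → F (ι p) = ι (S.F p)
  H : Set X
  isOpen_H : IsOpen H
  κ : ℝ
  κ_pos : 0 < κ
  c₁ : ℕ
  transport : ∀ A B : YMSpecies G, ∃ C : ℝ, ∀ g ∈ Set.Ioc 0 S.g₀, ∀ j : ℕ,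
    InChart S (g, S.yW g) j →
    ∀ m : ℕ, F^[m] (ι (S.F^[j] (g, S.yW g))) ∈ H →
    ∀ T n : ℕ, c₁ * M' ^ (j + m) ≤ 2 * T + 1 → n ≤ T →
      |latticeConnectedCorr r.ρ (S.betaOf g) (2 * T + 1) A.F B.F n| ≤
        C * Real.exp (-(κ * n / (M' : ℝ) ^ (j + m)))
  Cuv : ℝ
  uv_bound : ∀ g ∈ Set.Ioc 0 S.g₀, ∀ i : ℕ, InChart S (g, S.yW g) i →
    ∀ L D : ℕ, M' ^ i ≤ D → D < M' ^ (i + 1) → M' * D ≤ L →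
      (D : ℝ) ^ 8 *
          |latticeConnectedCorr r.ρ (S.betaOf g) (2 * L + 1) r.curvature.F r.curvature.F D| ≤
        Cuv * ((S.F^[i] (g, S.yW g)).1) ^ 4

attribute [instance] BridgeChart.instNormedAddCommGroup BridgeChart.instNormedSpace
  BridgeChart.instCompleteSpace

end StructureCopy

/-- **Stub 3 `ScaleAnchoring` of the skeleton `dissipative-bridge` holds** (statement inline = the skeleton's body):
the tuning anchors the landing scale. Use: `theorem stub_anchoring : ScaleAnchoring := scaleAnchoring_holds`. If `Cuv ≤ 0` the UV
pin gives `0`; otherwise set `g⋆ = min 1 (θ / (2 Cuv))` (so `Cuv g⋆⁴ ≤ θ/2`), `u = g⋆ / 2^{j₀}` with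
`θ'^{j₀} R ≤ ρ/2`, `d = (b/2) u³`, `w = j₀ + ⌈γ⁺/d⌉₊ + 1`: along an in-chart orbit with couplings `≤ γ⁺` up to step
`j`, if `Cuv g_i⁴ > θ/2` at some `i ≤ j − w` then `g_i > g⋆`, the coupling at most halves during the `j₀` absorption
steps and then climbs by `≥ d` per step, exceeding `γ⁺` at step `i + w ≤ j` — contradiction; so `Cuv g_i⁴ ≤ θ/2`
and `uv_bound` concludes. [folklore] -/
theorem scaleAnchoring_holds :
    ∀ (G : Type) [Group G] [TopologicalSpace G] [IsTopologicalGroup G] [CompactSpace G]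
      [MeasurableSpace G] [BorelSpace G] (r : LatticeRep G) (M' : ℕ) (S : BalabanBanachStep G r M')
      (𝔛 : BridgeChart S) (γ ρ : ℝ), TubeAdmissible S γ ρ → ∀ θ : ℝ, 0 < θ →
      ∃ (w : ℕ) (g₁ : ℝ), 0 < g₁ ∧ g₁ ≤ S.g₀ ∧ ∀ g ∈ Set.Ioc 0 g₁, ∀ j : ℕ,
        InChart S (g, S.yW g) j → (∀ l ≤ j, (S.F^[l] (g, S.yW g)).1 ≤ tubeTop S γ) →
        ∀ i L D : ℕ, i + w ≤ j → M' ^ i ≤ D → D < M' ^ (i + 1) → M' * D ≤ L →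
          (D : ℝ) ^ 8 *
              |latticeConnectedCorr r.ρ (S.betaOf g) (2 * L + 1) r.curvature.F r.curvature.F D| ≤
            θ / 2 := by
  intro G _ _ _ _ _ _ r M' S 𝔛 γ ρ hadm θ hθ
  have hadm' := hadm
  obtain ⟨hγ, hρ, hρR, htop, habs, hdrift, hhalf⟩ := hadm'
  have hθ0 := S.θ'_nonneg
  have hθ1 := S.θ'_lt_one
  have hRpos := S.R_pos
  have hb := S.b_pos
  have hγp : γ ≤ tubeTop S γ := le_tubeTop S hγ.le
  have hγp0 : 0 < tubeTop S γ := hγ.trans_le hγp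
  -- trivial case: non-positive UV constant
  by_cases hCuv : 𝔛.Cuv ≤ 0
  · refine ⟨0, S.g₀, S.g₀_pos, le_rfl, fun g hg j hchart _ i L D hij hD1 hD2 hL => ?_⟩
    have hci : InChart S (g, S.yW g) i := fun l hl => hchart l (hl.trans (by omega))
    have h := 𝔛.uv_bound g hg i hci L D hD1 hD2 hL
    have h4 : 0 ≤ ((S.F^[i] (g, S.yW g)).1) ^ 4 := by positivity
    have : 𝔛.Cuv * ((S.F^[i] (g, S.yW g)).1) ^ 4 ≤ 0 := mul_nonpos_of_nonpos_of_nonneg hCuv h4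
    linarith
  push Not at hCuv
  -- the threshold coupling g⋆ with Cuv g⋆⁴ ≤ θ/2
  set gs : ℝ := min 1 (θ / (2 * 𝔛.Cuv)) with hgs
  have hgs0 : 0 < gs := lt_min one_pos (by positivity)
  have hgs1 : gs ≤ 1 := min_le_left _ _
  have hgsθ : 𝔛.Cuv * gs ^ 4 ≤ θ / 2 := by
    have h1 : gs ^ 4 ≤ gs := by
      have : gs ^ 4 ≤ gs ^ 1 := pow_le_pow_of_le_one hgs0.le hgs1 (by norm_num)
      simpa using this
    have h2 : gs ≤ θ / (2 * 𝔛.Cuv) := min_le_right _ _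
    calc 𝔛.Cuv * gs ^ 4 ≤ 𝔛.Cuv * (θ / (2 * 𝔛.Cuv)) :=
          mul_le_mul_of_nonneg_left (h1.trans h2) hCuv.le
      _ = θ / 2 := by field_simp
  -- absorption time
  obtain ⟨j₀, hj₀⟩ : ∃ j₀ : ℕ, S.θ' ^ j₀ * S.R ≤ ρ / 2 := by
    obtain ⟨n, hn⟩ := exists_pow_lt_of_lt_one (show 0 < ρ / (2 * S.R) by positivity) hθ1
    refine ⟨n, ?_⟩
    have := (lt_div_iff₀ (by positivity : (0 : ℝ) < 2 * S.R)).1 hn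
    linarith
  set u : ℝ := gs / 2 ^ j₀ with hu
  have hu0 : 0 < u := by positivity
  set d : ℝ := S.b / 2 * u ^ 3 with hd
  have hd0 : 0 < d := by positivity
  set N : ℕ := ⌈tubeTop S γ / d⌉₊ with hN
  have hNd : tubeTop S γ ≤ N * d := by
    have h := Nat.le_ceil (tubeTop S γ / d)
    rw [div_le_iff₀ hd0] at h
    exact h
  refine ⟨j₀ + N + 1, S.g₀, S.g₀_pos, le_rfl, fun g hg j hchart htube i L D hij hD1 hD2 hL => ?_⟩
  -- the orbit
  set p : ℕ → ℝ × S.E := fun l => S.F^[l] (g, S.yW g) with hp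
  have psucc : ∀ l, p (l + 1) = S.F (p l) := fun l => Function.iterate_succ_apply' _ _ _
  have Ffst : ∀ q : ℝ × S.E, (S.F q).1 = S.φ q.1 q.2 := fun q => rfl
  have Fsnd : ∀ q : ℝ × S.E, (S.F q).2 = S.Ψ q.1 q.2 := fun q => rfl
  have hc0 : ∀ l ≤ j, 0 ≤ (p l).1 := fun l hl => (hchart l hl).1.1
  have hcR : ∀ l ≤ j, ‖(p l).2‖ ≤ S.R := fun l hl => (hchart l hl).2
  have hcp : ∀ l ≤ j, (p l).1 ≤ tubeTop S γ := fun l hl => htube l hl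
  have hci : InChart S (g, S.yW g) i := fun l hl => hchart l (hl.trans (by omega))
  have hUV := 𝔛.uv_bound g hg i hci L D hD1 hD2 hL
  -- it suffices that Cuv g_i⁴ ≤ θ/2
  suffices hsuff : 𝔛.Cuv * ((p i).1) ^ 4 ≤ θ / 2 from hUV.trans hsuff
  by_contra hbig
  push Not at hbig
  -- then g_i > g⋆
  have hgi : gs < (p i).1 := by
    by_contra hle
    push Not at hle
    have : (p i).1 ^ 4 ≤ gs ^ 4 := pow_le_pow_left₀ (hc0 i (by omega)) hle 4
    have : 𝔛.Cuv * (p i).1 ^ 4 ≤ 𝔛.Cuv * gs ^ 4 := mul_le_mul_of_nonneg_left this hCuv.le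
    linarith
  -- (a) halving during absorption: g_{i+m} ≥ g⋆ / 2^m for m ≤ j₀
  have H1 : ∀ m, m ≤ j₀ → gs / 2 ^ m ≤ (p (i + m)).1 := by
    intro m
    induction m with
    | zero => intro _; simpa using hgi.le
    | succ m ih =>
      intro hm
      have him : i + m ≤ j := by omega
      have hprev := ih (Nat.le_of_succ_le hm)
      have hlow := step_lower S hadm (hc0 _ him) (hcp _ him) (hcR _ him)
      rw [show i + (m + 1) = (i + m) + 1 by ring, psucc, Ffst]
      rw [pow_succ]
      have : gs / (2 ^ m * 2) = (gs / 2 ^ m) / 2 := by ring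
      rw [this]
      linarith
  -- (b) fibre absorption along the segment
  have H2 : ∀ m, i + m ≤ j → ‖(p (i + m)).2‖ ≤ S.θ' ^ m * S.R + ρ / 2 := by
    intro m
    induction m with
    | zero =>
      intro him
      have := hcR i (by simpa using him)
      simp only [add_zero, pow_zero, one_mul]
      linarith
    | succ m ih =>
      intro him
      have him' : i + m ≤ j := by omega
      have hprev := ih him'
      have hfib := step_fibre S hadm (hc0 _ him') (hcp _ him') (hcR _ him')
      have h2 := C_sq_le S hadm
      rw [show i + (m + 1) = (i + m) + 1 by ring, psucc, Fsnd]
      calc ‖S.Ψ (p (i + m)).1 (p (i + m)).2‖ ≤ S.θ' * ‖(p (i + m)).2‖ + S.C * (tubeTop S γ) ^ 2 := hfib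
        _ ≤ S.θ' * (S.θ' ^ m * S.R + ρ / 2) + (1 - S.θ') * ρ / 2 :=
            add_le_add (mul_le_mul_of_nonneg_left hprev hθ0) h2
        _ = S.θ' ^ (m + 1) * S.R + ρ / 2 := by ring
  have H3 : ∀ m, j₀ ≤ m → i + m ≤ j → ‖(p (i + m)).2‖ ≤ ρ := by
    intro m hm him
    have h := H2 m him
    have hpow : S.θ' ^ m ≤ S.θ' ^ j₀ := pow_le_pow_of_le_one hθ0 hθ1.le hm
    have : S.θ' ^ m * S.R ≤ S.θ' ^ j₀ * S.R := mul_le_mul_of_nonneg_right hpow hRpos.le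
    linarith
  -- (c) linear climb after absorption
  have H4 : ∀ n : ℕ, i + (j₀ + n) ≤ j → u + n * d ≤ (p (i + (j₀ + n))).1 := by
    intro n
    induction n with
    | zero =>
      intro _
      simpa [hu] using H1 j₀ le_rfl
    | succ n ih =>
      intro hidx
      have hidx' : i + (j₀ + n) ≤ j := by omega
      have hprev := ih hidx'
      have hx0 : 0 ≤ (p (i + (j₀ + n))).1 := hc0 _ hidx'
      have hxp := hcp _ hidx'
      have hxy : ‖(p (i + (j₀ + n))).2‖ ≤ ρ := H3 (j₀ + n) (Nat.le_add_right _ _) hidx'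
      have hdr := step_drift S hadm hx0 hxp hxy
      have hge_u : u ≤ (p (i + (j₀ + n))).1 := by
        have : (0 : ℝ) ≤ n * d := by positivity
        linarith
      have hcube : u ^ 3 ≤ (p (i + (j₀ + n))).1 ^ 3 := pow_le_pow_left₀ hu0.le hge_u 3
      have hmul : S.b / 2 * u ^ 3 ≤ S.b / 2 * (p (i + (j₀ + n))).1 ^ 3 :=
        mul_le_mul_of_nonneg_left hcube (by positivity)
      rw [show i + (j₀ + (n + 1)) = (i + (j₀ + n)) + 1 by ring, psucc, Ffst]
      push_cast
      nlinarith
  -- contradiction at step i + w ≤ j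
  have hidx : i + (j₀ + (N + 1)) ≤ j := by omega
  have hclimb := H4 (N + 1) hidx
  have htop' := hcp _ hidx
  push_cast at hclimb
  nlinarith

end

end Summit.QuantumFields.YangMills.Theorems.LatticeGapOnTrajectory.Negative.Stubs
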